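import Summits.CriticalPhenomena.PercolationContinuityZ3.Theorems.Transplant.SkelFrmBParamsCorrKGLenY
import HarnessLib

/-!
# N2 (frames-only node `SamePDropOfSkeletonFrm₁`, OPEN) — (ζ″) ledger under J23/(R-44): THE CORRIDOR BUDGETS AT THE WIDER WINDOW OF RECORD
# `BSlot.small2 = (48·s₀, 16·s₁)` — successor residual floors **`KGRes2`** (`qx ≤ 70·n_L`, `Wx ≤ 20·sL`) and **`KGResY2`** (`qx ≤ 40·sL`, `Wx ≤ 70·n_L`)
# and the two length budgets re-proved under them; `LfQ = 80·K` UNCHANGED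

At `small2` the start box is `aWS small2 ≤ 67·n_L` wide (Window2), so the x-run's along start window `q = 2n_L + qx` and the y′-run's across window
`W_Y = 2n_L + Wx` both grow from `41·n_L` to `67·n_L`, beyond the `KGRes/KGResY` caps `40·n_L` behind `kgSchedN_le_LfQ`/`kgSchedNY_le_LfQ`.  The budget
`LfQ = 80·K` has the slack: generic bounds `2n(m₂+1) ≤ 6X₂ + 3` with `q ≤ 72n` give `2(m₂+1) ≤ 436 + N + 7(m₁+1)` (x) and `W ≤ 72n` gives
`8(m₁Y+1) ≤ 3456/2 + 3(N+1)` (y), so `N + 1 + (m₁+1) + (m₂+1) ≤ 80K` still holds for `K ≥ 40`.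
* `KGRows.kgSchedN_budget2` (`q ≤ 72n`), `KGYRows.kgM₁Y_succ_budget2`/`kgSchedNY_budget2` (`W ≤ 72n`); `KGRes2`, `KGResY2`, `kg_floors2`,
  **`kgSchedN_le_LfQ2`**, **`kgSchedNY_le_LfQ2`**.
NON-VACUITY: pure budget rows; binder set = the landed budgets' (`EqNumL`, `gFloorKG ≤ g`, the residual caps).
builds on p205010 (kernel theorem, internal audit signed; external expert review pending) — nothing in this file uses p205010; NOTHING is claimed about the
open node `SamePDropOfSkeletonFrm₁`.
Lane `prim-bschramm`, seat `prim-bschramm-stmt` (gen 21); helper file (`--supports stmt-CriticalPhenomena-4575 --as helper`).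
[cite: KozmaNitzan2024, §4 Lemma 12 (pp. 23–25), p. 26 (29)] [cite: MartineauTassion2017, §4.3 Lemma 4.2]
-/

open scoped Classical

noncomputable section

namespace Summit.CriticalPhenomena.PercolationContinuityZ3.Theorems.Transplant

namespace Skelφ

open Literature.Probability.Percolation Literature.Probability.LatticeModels SimpleGraph

section Budget2

variable {n ℓ : ℕ} {hs v : ℤ} {R' ρ q W : ℕ}

/-- **THE LENGTH BUDGET, generic, first axis, at `q ≤ 72n`**: `N + 1 + (m₁+1) + (m₂+1) ≤ 80·K` (`K ≥ 40`, `N ≤ 20K + 4`). [this work] -/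
theorem KGRows.kgSchedN_budget2 (H : KGRows n ℓ hs v R' ρ q W) (hS : 3 * (2 * (R' : ℤ) + ρ) ≤ kgSL n ℓ hs) (hSn : 3 * (2 * (R' : ℤ) + ρ) ≤ n)
    (hR8 : 8 * (R' : ℤ) ≤ kgSL n ℓ hs) (hW2 : (W : ℤ) ≤ 21 * kgSL n ℓ hs) (hq6 : (q : ℤ) ≤ 72 * n) {K : ℤ} (hK : 40 ≤ K) (N : ℕ)
    (hNK : (N : ℤ) ≤ 20 * K + 4) :
    (N : ℤ) + 1 + ((((kgM₁ n ℓ hs R' ρ W N : ℕ) : ℤ)) + 1) + ((((kgM₂ n ℓ hs v R' ρ q W N : ℕ) : ℤ)) + 1) ≤ 80 * K := by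
  have f1 := H.kgM₁_succ_budget hS hW2 hR8 N
  have f2 := H.kgM₂_succ_budget hSn N
  have hρv := H.hρv
  have hn1 : (1 : ℤ) ≤ n := by exact_mod_cast H.hn
  have hR0 : (0 : ℤ) ≤ R' := by positivity
  have hρ0 : (0 : ℤ) ≤ ρ := by positivity
  have ha : (0 : ℤ) ≤ |v| := abs_nonneg _
  set a := (((kgM₁ n ℓ hs R' ρ W N : ℕ) : ℤ)) + 1 with ha_def
  set b := (((kgM₂ n ℓ hs v R' ρ q W N : ℕ) : ℤ)) + 1 with hb_def
  have ha0 : 0 ≤ a := by positivity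
  have hb0 : 0 ≤ b := by positivity
  have hN0 : (0 : ℤ) ≤ (N : ℤ) + 1 := by positivity
  have hX₂ : kgX₂ n ℓ hs v R' ρ q W N = (q : ℤ) + ((N : ℤ) + 1) * R' + a * ((R' : ℤ) + ρ + |v|) := by unfold kgX₂; ring
  have g1 : a * ((R' : ℤ) + ρ + |v|) ≤ a * R' + a * n := by nlinarith
  have g2 : 6 * (a * (R' : ℤ)) ≤ a * n := by nlinarith
  have g3 : 6 * (((N : ℤ) + 1) * R') ≤ ((N : ℤ) + 1) * n := by nlinarith
  have g4 : 6 * kgX₂ n ℓ hs v R' ρ q W N ≤ (433 + (N : ℤ) + 7 * a) * n := by rw [hX₂]; nlinarith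
  have g5 : 2 * (n : ℤ) * b ≤ (436 + (N : ℤ) + 7 * a) * n := by nlinarith
  have g6 : 2 * b ≤ 436 + (N : ℤ) + 7 * a := by
    have : (n : ℤ) * (2 * b) ≤ (n : ℤ) * (436 + (N : ℤ) + 7 * a) := by nlinarith
    exact le_of_mul_le_mul_left this (by linarith)
  linarith

/-- **`8·(m₁Y+1) ≤ 1728 + 3(N+1)`** (second axis) under `3(2R′+ρ) ≤ n`, `W ≤ 72n`, `8R′ ≤ n`. [this work] -/
theorem KGYRows.kgM₁Y_succ_budget2 (H : KGYRows n ℓ hs v R' ρ q W) (hSn : 3 * (2 * (R' : ℤ) + ρ) ≤ n) (hW : (W : ℤ) ≤ 72 * n)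
    (hR8 : 8 * (R' : ℤ) ≤ n) (N : ℕ) :
    8 * ((((kgM₁Y n v R' ρ W N : ℕ) : ℤ)) + 1) ≤ 1728 + 3 * ((N : ℤ) + 1) := by
  have hb := H.kgM₁Y_budget hSn N
  have hn : (1 : ℤ) ≤ n := by exact_mod_cast H.hn
  have ha : (0 : ℤ) ≤ |v| := abs_nonneg _
  have hN0 : (0 : ℤ) ≤ (N : ℤ) + 1 := by positivity
  unfold kgT₁Y at hb
  have h1 : 8 * (2 * (n : ℤ) * ((((kgM₁Y n v R' ρ W N : ℕ) : ℤ)) + 1)) ≤ (n : ℤ) * (3456 + 6 * ((N : ℤ) + 1)) := by nlinarith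
  have h2 : (n : ℤ) * (16 * ((((kgM₁Y n v R' ρ W N : ℕ) : ℤ)) + 1)) ≤ (n : ℤ) * (3456 + 6 * ((N : ℤ) + 1)) := by linarith
  have := le_of_mul_le_mul_left h2 (by linarith)
  linarith

/-- **THE LENGTH BUDGET, generic, second axis, at `W ≤ 72n`**: `N + 1 + (m₁+1) + (m₂+1) ≤ 80·K` (`K ≥ 40`, `N ≤ 21K + 2`). [this work] -/
theorem KGYRows.kgSchedNY_budget2 (H : KGYRows n ℓ hs v R' ρ q W) (hSn : 3 * (2 * (R' : ℤ) + ρ) ≤ n) (hS : 3 * (2 * (R' : ℤ) + ρ) ≤ kgSLY n ℓ hs)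
    (hR8 : 8 * (R' : ℤ) ≤ n) (hW : (W : ℤ) ≤ 72 * n) (hq : (q : ℤ) ≤ 41 * kgSLY n ℓ hs + 2) (hρP : (ρ : ℤ) ≤ (n * ℓ / shearUnit n hs : ℕ) + 2)
    (hbig : 958 ≤ kgSLY n ℓ hs) {K : ℤ} (hK : 40 ≤ K) (N : ℕ) (hNK : (N : ℤ) ≤ 21 * K + 2) :
    (N : ℤ) + 1 + ((((kgM₁Y n v R' ρ W N : ℕ) : ℤ)) + 1) + ((((kgM₂Y n ℓ hs v R' ρ q W N : ℕ) : ℤ)) + 1) ≤ 80 * K := by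
  have f1 := H.kgM₁Y_succ_budget2 hSn hW hR8 N
  have f2 := H.kgM₂Y_succ_budget hS hρP N
  have hR0 : (0 : ℤ) ≤ R' := by positivity
  have hρ0 : (0 : ℤ) ≤ ρ := by positivity
  have hdS : ((dS n ℓ hs : ℕ) : ℤ) ≤ 2 := by exact_mod_cast dS_le_two n ℓ hs
  have hdS0 : (0 : ℤ) ≤ ((dS n ℓ hs : ℕ) : ℤ) := by positivity
  set a := (((kgM₁Y n v R' ρ W N : ℕ) : ℤ)) + 1 with ha_def
  set b := (((kgM₂Y n ℓ hs v R' ρ q W N : ℕ) : ℤ)) + 1 with hb_def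
  set s := kgSLY n ℓ hs with hs_def
  have ha0 : 0 ≤ a := by positivity
  have hb0 : 0 ≤ b := by positivity
  have hN0 : (0 : ℤ) ≤ (N : ℤ) + 1 := by positivity
  have hT : kgTY n ℓ hs v R' ρ q W N = 2 * (q : ℤ) + 2 * (((N : ℤ) + 1) * R') + ((N : ℤ) + 1) * (dS n ℓ hs : ℕ) + 2 * (a * ((R' : ℤ) + ρ)) := by
    unfold kgTY; ring
  have g1 : 3 * (a * ((R' : ℤ) + ρ)) ≤ a * s := by nlinarith
  have g2 : 6 * (((N : ℤ) + 1) * R') ≤ ((N : ℤ) + 1) * s := by nlinarith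
  have g3 : 3 * (((N : ℤ) + 1) * (dS n ℓ hs : ℕ)) ≤ ((N : ℤ) + 1) * s := by nlinarith
  have g5 : 2 * s * b ≤ (247 + 2 * ((N : ℤ) + 1) + 2 * a) * s := by rw [hT] at f2; nlinarith
  have g6 : 2 * b ≤ 247 + 2 * ((N : ℤ) + 1) + 2 * a := by
    have : s * (2 * b) ≤ s * (247 + 2 * ((N : ℤ) + 1) + 2 * a) := by nlinarith
    exact le_of_mul_le_mul_left this (by linarith)
  linarith

end Budget2

end Skelφ

/-! ## At the values of record (`ρ := 0`): the successor residual floors and the two budgets -/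

namespace PlanarSkeletonFrm

namespace NegB

open Literature.Probability.Percolation Literature.Probability.LatticeModels SimpleGraph
open SkelConc (Consts)
open Skelφ (shearUnit kgSL kgSLY kgM₁ kgM₂ kgM₁Y kgM₂Y KGRows KGYRows)
open Neg

section Values2

variable (κ : Consts) {V : Type} [DecidableEq V] [Countable V] {G : SimpleGraph V} [G.LocallyFinite] (Φ : PlanarSkeletonFrm G) (t : V) (p : unitInterval)
  (D : Skelφ.StepI.DataNS V) (g f mk qx Wx : ℕ)

/-- **The successor residual floors, first axis** (room for `small2`'s start box): `qx ≤ 70·n_L`, `Wx ≤ 20·sL`. [this work] -/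
structure KGRes2 : Prop where
  /-- `qx ≤ 70·n_L` -/
  hqx : qx ≤ 70 * nL κ Φ t p D g f
  /-- `Wx ≤ 20·sL` -/
  hWx : (Wx : ℤ) ≤ 20 * kgSL (nL κ Φ t p D g f) (ℓL κ Φ t p D g f) (hL κ Φ t p D g f)

/-- **The successor residual floors, second axis**: `qx ≤ 40·sL` (rows), `Wx ≤ 70·n_L` (x′ units). [this work] -/
structure KGResY2 : Prop where
  /-- `qx ≤ 40·sL` -/
  hqx : (qx : ℤ) ≤ 40 * kgSLY (nL κ Φ t p D g f) (ℓL κ Φ t p D g f) (hL κ Φ t p D g f)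
  /-- `Wx ≤ 70·n_L` -/
  hWx : Wx ≤ 70 * nL κ Φ t p D g f

/-- `KGRes2` keeps `KGRes`'s across cap, so `kg_floors` applies. [folklore] -/
theorem KGRes2.toWx (hx : KGRes2 κ Φ t p D g f qx Wx) : (Wx : ℤ) ≤ 20 * kgSL (nL κ Φ t p D g f) (ℓL κ Φ t p D g f) (hL κ Φ t p D g f) := hx.hWx

/-- **THE CORRIDOR FITS THE BUDGET at the wider along window** (`ρ := 0`, `KGRes2`): `N + 1 + (m₁+1) + (m₂+1) ≤ LfQ κ.K₀`. [this work] -/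
theorem kgSchedN_le_LfQ2 (hN : EqNumL κ Φ t p D g f) (hg : gFloorKG κ Φ t p D mk ≤ g) (hx : KGRes2 κ Φ t p D g f qx Wx) :
    kgNv0 κ Φ t p D g f mk qx Wx + 1 +
        (kgM₁ (nL κ Φ t p D g f) (ℓL κ Φ t p D g f) (hL κ Φ t p D g f) (kgR κ Φ t p D mk) 0 (kgW κ Φ t p D g f Wx)
          (kgNv0 κ Φ t p D g f mk qx Wx) + 1) +
        (kgM₂ (nL κ Φ t p D g f) (ℓL κ Φ t p D g f) (hL κ Φ t p D g f) (vL κ Φ t p D g f) (kgR κ Φ t p D mk) 0 (kgq κ Φ t p D g f qx)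
          (kgW κ Φ t p D g f Wx) (kgNv0 κ Φ t p D g f mk qx Wx) + 1) ≤ LfQ κ.K₀ := by
  have H := kgRows0_of κ Φ t p D g f mk qx Wx hN hg
  obtain ⟨hS, hSn, -, hR8, hW2⟩ := kg_floors κ Φ t p D g f mk Wx hN hg hx.hWx
  have hNle := kgNv0_le κ Φ t p D g f mk qx Wx hN hg
  have hK := (Skelφ.NegPrm.forty_le_Kcell κ.K₀).1
  have hK' : (40 : ℤ) ≤ (Neg.K κ : ℤ) := by unfold Neg.K; exact_mod_cast hK
  have hNz : ((kgNv0 κ Φ t p D g f mk qx Wx : ℕ) : ℤ) ≤ 20 * (Neg.K κ : ℤ) + 4 := by exact_mod_cast hNle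
  have hq6 : ((kgq κ Φ t p D g f qx : ℕ) : ℤ) ≤ 72 * (nL κ Φ t p D g f : ℤ) := by
    have hqx : qx ≤ 70 * nL κ Φ t p D g f := hx.hqx
    unfold kgq; push_cast
    have : ((qx : ℕ) : ℤ) ≤ 70 * (nL κ Φ t p D g f : ℤ) := by exact_mod_cast hqx
    linarith
  have hb := H.kgSchedN_budget2 hS hSn hR8 hW2 hq6 hK' (kgNv0 κ Φ t p D g f mk qx Wx) hNz
  have hZ : ((kgNv0 κ Φ t p D g f mk qx Wx + 1 +
        (kgM₁ (nL κ Φ t p D g f) (ℓL κ Φ t p D g f) (hL κ Φ t p D g f) (kgR κ Φ t p D mk) 0 (kgW κ Φ t p D g f Wx)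
          (kgNv0 κ Φ t p D g f mk qx Wx) + 1) +
        (kgM₂ (nL κ Φ t p D g f) (ℓL κ Φ t p D g f) (hL κ Φ t p D g f) (vL κ Φ t p D g f) (kgR κ Φ t p D mk) 0 (kgq κ Φ t p D g f qx)
          (kgW κ Φ t p D g f Wx) (kgNv0 κ Φ t p D g f mk qx Wx) + 1) : ℕ) : ℤ) ≤ ((LfQ κ.K₀ : ℕ) : ℤ) := by
    rw [LfQ_eq]; push_cast; linarith
  exact_mod_cast hZ

/-- **THE N-CORRIDOR FITS THE BUDGET at the wider across window** (`ρ := 0`, `KGResY2`): `N + 1 + (m₁+1) + (m₂+1) ≤ LfQ κ.K₀`. [this work] -/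
theorem kgSchedNY_le_LfQ2 (hN : EqNumL κ Φ t p D g f) (hg : gFloorKG κ Φ t p D mk ≤ g) (hx : KGResY2 κ Φ t p D g f qx Wx) :
    kgNYv0 κ Φ t p D g f mk qx Wx + 1 +
        (kgM₁Y (nL κ Φ t p D g f) (vL κ Φ t p D g f) (kgR κ Φ t p D mk) 0 (kgWY κ Φ t p D g f Wx) (kgNYv0 κ Φ t p D g f mk qx Wx) + 1) +
        (kgM₂Y (nL κ Φ t p D g f) (ℓL κ Φ t p D g f) (hL κ Φ t p D g f) (vL κ Φ t p D g f) (kgR κ Φ t p D mk) 0 (kgqY κ Φ t p D g f qx)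
          (kgWY κ Φ t p D g f Wx) (kgNYv0 κ Φ t p D g f mk qx Wx) + 1) ≤ LfQ κ.K₀ := by
  have H := kgYRows0_of κ Φ t p D g f mk qx Wx hN hg
  obtain ⟨hSn, hS, hR8, hbig, hρP⟩ := kgY_floors κ Φ t p D g f mk hN hg
  have hNle := kgNYv0_le κ Φ t p D g f mk qx Wx hN hg
  have hK := (Skelφ.NegPrm.forty_le_Kcell κ.K₀).1
  have hK' : (40 : ℤ) ≤ (Neg.K κ : ℤ) := by unfold Neg.K; exact_mod_cast hK
  have hNz : ((kgNYv0 κ Φ t p D g f mk qx Wx : ℕ) : ℤ) ≤ 21 * (Neg.K κ : ℤ) + 2 := by exact_mod_cast hNle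
  have hW : ((kgWY κ Φ t p D g f Wx : ℕ) : ℤ) ≤ 72 * (nL κ Φ t p D g f : ℤ) := by
    have hWx : Wx ≤ 70 * nL κ Φ t p D g f := hx.hWx
    unfold kgWY; push_cast
    have : ((Wx : ℕ) : ℤ) ≤ 70 * (nL κ Φ t p D g f : ℤ) := by exact_mod_cast hWx
    linarith
  have hq : ((kgqY κ Φ t p D g f qx : ℕ) : ℤ) ≤ 41 * kgSLY (nL κ Φ t p D g f) (ℓL κ Φ t p D g f) (hL κ Φ t p D g f) + 2 := by
    have hqx := hx.hqx
    have hPd := Skelφ.natDiv_le_kgSLY (one_le_of_eqNumL κ Φ t p D g f hN).1 (ℓL κ Φ t p D g f) (hL κ Φ t p D g f)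
    unfold kgqY
    push_cast [Nat.cast_add] at hPd ⊢
    linarith
  have hb := H.kgSchedNY_budget2 hSn hS hR8 hW hq hρP hbig hK' (kgNYv0 κ Φ t p D g f mk qx Wx) hNz
  have hZ : ((kgNYv0 κ Φ t p D g f mk qx Wx + 1 +
        (kgM₁Y (nL κ Φ t p D g f) (vL κ Φ t p D g f) (kgR κ Φ t p D mk) 0 (kgWY κ Φ t p D g f Wx) (kgNYv0 κ Φ t p D g f mk qx Wx) + 1) +
        (kgM₂Y (nL κ Φ t p D g f) (ℓL κ Φ t p D g f) (hL κ Φ t p D g f) (vL κ Φ t p D g f) (kgR κ Φ t p D mk) 0 (kgqY κ Φ t p D g f qx)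
          (kgWY κ Φ t p D g f Wx) (kgNYv0 κ Φ t p D g f mk qx Wx) + 1) : ℕ) : ℤ) ≤ ((LfQ κ.K₀ : ℕ) : ℤ) := by
    rw [LfQ_eq]; push_cast; linarith
  exact_mod_cast hZ

end Values2

end NegB

end PlanarSkeletonFrm

end Summit.CriticalPhenomena.PercolationContinuityZ3.Theorems.Transplant

end
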